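import Literature.NumberTheory.Transcendental.RoySmallValueOrbitsK
import Literature.NumberTheory.Transcendental.RoySmallValueLiouville
import HarnessLib

/-!
# Roy's small value estimate for `𝔾ₐ × 𝔾ₘ` — Liouville's inequality on a Galois orbit of `𝒵(P, Q)`

Topic `Literature/NumberTheory/Transcendental`. Part of the formalisation of the proof of Roy 2013,
Theorem 1.1 (named fact `roy2013_thm_1_1`, `RoySmallValueEstimates.lean`), seat B. Source: D. Roy,
*A small value estimate for `𝔾ₐ × 𝔾ₘ`*, Mathematika 59 (2013) 333–363 = arXiv:1301.0663,
Proposition 2.4 (p. 7) as used in §7, Step 4 (p. 19):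

> Then, Proposition 2.4 gives `0 ≤ 7 log(3) D* deg(Z) + D* h(Z) + ∑_{α ∈ Z} log|P*(α)|`

(for `P* ∈ ℤ[X]_{D*}` not vanishing on the zero-dimensional `ℚ`-subvariety `Z`, `α` running over
sup-normalised representatives of the points of `Z(ℂ)`).

For an orbit `O = Z.orb i₀` of a configuration of zeros `Z : ZeroConfigK K ι` (the parallel seat's
`RoySmallValueOrbitsK`: `K ⊂ ℂ` a normal number field, `K`-rational normalised representatives
`Z.rep j` with complex points `Z.α j`, `Gal(K/ℚ)` permuting them via `Z.perm`) and an integer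
form `P ∈ ℤ[X]_D` with `P(α_{i₀}) ≠ 0`, we prove (`orbit_liouville_log`)

  `0 ≤ D · ∑_{j ∈ O} h_K(rep j) + [K:ℚ] · ∑_{j ∈ O} log( |P(α_j)| / ‖α_j‖^D )`,

i.e., with `h(O) := ∑_{j∈O} h_K(rep j)/[K:ℚ]` (the height of the component), Roy's inequality
`0 ≤ D h(Z) + ∑_{α∈Z} log|P(α/‖α‖)|` with the constant `7 log(3) D deg Z` improved to `0`
(Mathlib's Weil height uses the sup norm at the archimedean places). It is the per-point Liouville
inequality `neg_logHeight_le_sum_log` (`RoySmallValueLiouville`, a sum over the embeddings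
`σ : K → ℂ`) summed over the orbit and rearranged with `ZeroConfigK.sum_orb_sum_emb`
(`∑_{j∈O} ∑_σ F(σ a_j) = #Aut · ∑_{j∈O} F(α_j)`). Also: `P(α_j) ≠ 0` for all `j ∈ O` as soon
as `P(α_{i₀}) ≠ 0` (`aeval_rep_ne_zero_of_mem_orb`). Everything is proved; no definitions, no
named facts.

## References

* [Roy2013] D. Roy, *A small value estimate for 𝔾ₐ × 𝔾ₘ*, Mathematika 59 (2013), 333–363
  (arXiv:1301.0663), Proposition 2.4 and §7, Step 4 (first display).
-/

noncomputable section

open MvPolynomial Finset Height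

namespace Literature.NumberTheory.Transcendental

namespace Roy2013

namespace ZeroConfigK

variable {K : IntermediateField ℚ ℂ} {ι : Type*} [Fintype ι] (Z : ZeroConfigK K ι)

omit [Fintype ι] in
/-- Ring homomorphisms commute with evaluation of integer polynomials. [folklore] -/
theorem hom_aeval_int {A B : Type*} [CommRing A] [CommRing B] (φ : A →+* B) (a : Fin 3 → A)
    (P : MvPolynomial (Fin 3) ℤ) : φ (aeval a P) = aeval (φ ∘ a) P := by
  rw [map_aeval, aeval_def, RingHom.ext_int (φ.comp (algebraMap ℤ A)) (algebraMap ℤ B)]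
  rfl

/-- The value at the complex point: `P(α_j) = P(rep j)` viewed in `ℂ`. [folklore] -/
theorem coe_aeval_rep_int (j : ι) (P : MvPolynomial (Fin 3) ℤ) :
    ((aeval (Z.rep j) P : K) : ℂ) = aeval (Z.α j) P := by
  have h := hom_aeval_int ((algebraMap K ℂ : K →+* ℂ)) (Z.rep j) P
  have hcomp : ((algebraMap K ℂ : K →+* ℂ) ∘ Z.rep j : Fin 3 → ℂ) = Z.α j :=
    funext fun k => Z.coe_rep j k
  rw [hcomp] at h
  exact h

variable [Normal ℚ K] [NumberField K]

omit [Normal ℚ K] in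
/-- **`P(α_j) ≠ 0` on the whole orbit** if `P(α_{i₀}) ≠ 0` (`P` with integer coefficients).
[cite: Roy2013, §7, Step 4 ("`Z` is not contained in the curve … defined by `P*`")] -/
theorem aeval_rep_ne_zero_of_mem_orb [DecidableEq ι] {i₀ j : ι} (hj : j ∈ Z.orb i₀)
    {P : MvPolynomial (Fin 3) ℤ} (hP : aeval (Z.rep i₀) P ≠ 0) : aeval (Z.rep j) P ≠ 0 := by
  obtain ⟨-, g, rfl⟩ := mem_filter.mp hj
  rw [← Z.rep_perm g i₀]
  have h : aeval (fun k => g (Z.rep i₀ k)) P = (g : K →+* K) (aeval (Z.rep i₀) P) :=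
    (hom_aeval_int (g : K →+* K) (Z.rep i₀) P).symm
  rw [h]
  exact (map_ne_zero_iff _ g.injective).mpr hP

/-- **Liouville's inequality on a Galois orbit** (Roy's Prop. 2.4 for the component `Z = O`):
for `P ∈ ℤ[X]_D` with `P(α_{i₀}) ≠ 0`,
`0 ≤ D ∑_{j∈O} h_K(rep j) + [K:ℚ] ∑_{j∈O} log(|P(α_j)| / ‖α_j‖^D)`.
[cite: Roy2013, Proposition 2.4; §7, Step 4 (first display)] -/
theorem orbit_liouville_log [DecidableEq ι] (i₀ : ι) {P : MvPolynomial (Fin 3) ℤ} {D : ℕ}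
    (hP : P.IsHomogeneous D) (hP0 : aeval (Z.rep i₀) P ≠ 0) :
    0 ≤ D * ∑ j ∈ Z.orb i₀, logHeight (Z.rep j) +
      Module.finrank ℚ K * ∑ j ∈ Z.orb i₀, Real.log (‖aeval (Z.α j) P‖ / ‖Z.α j‖ ^ D) := by
  -- per point: `-D h(rep j) ≤ ∑_σ log(|σ P(rep j)| / ‖σ ∘ rep j‖^D)`
  have hpt : ∀ j ∈ Z.orb i₀, -(D * logHeight (Z.rep j)) ≤
      ∑ σ : K →+* ℂ, Real.log (‖aeval (σ ∘ Z.rep j) P‖ / ‖(σ ∘ Z.rep j : Fin 3 → ℂ)‖ ^ D) := by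
    intro j hj
    have h := neg_logHeight_le_sum_log hP (Z.rep_ne_zero j) (Z.aeval_rep_ne_zero_of_mem_orb hj hP0)
    refine h.trans (le_of_eq (Finset.sum_congr rfl fun σ _ => ?_))
    rw [hom_aeval_int]
  have hsum := Finset.sum_le_sum hpt
  rw [Z.sum_orb_sum_emb i₀ (fun β : Fin 3 → ℂ => Real.log (‖aeval β P‖ / ‖β‖ ^ D)),
    card_aut_eq_finrank K, nsmul_eq_mul, Finset.sum_neg_distrib, ← Finset.mul_sum] at hsum
  linarith

/-- The same with the height of the orbit `h(O) = ∑_{j∈O} h_K(rep j) / [K:ℚ]` made explicit: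
`0 ≤ D h(O) + ∑_{j∈O} log(|P(α_j)| / ‖α_j‖^D)`. [cite: Roy2013, Proposition 2.4; §7, Step 4] -/
theorem orbit_liouville_log' [DecidableEq ι] (i₀ : ι) {P : MvPolynomial (Fin 3) ℤ} {D : ℕ}
    (hP : P.IsHomogeneous D) (hP0 : aeval (Z.rep i₀) P ≠ 0) :
    0 ≤ D * ((∑ j ∈ Z.orb i₀, logHeight (Z.rep j)) / Module.finrank ℚ K) +
      ∑ j ∈ Z.orb i₀, Real.log (‖aeval (Z.α j) P‖ / ‖Z.α j‖ ^ D) := by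
  have h := Z.orbit_liouville_log i₀ hP hP0
  have hn : (0 : ℝ) < Module.finrank ℚ K := by exact_mod_cast Module.finrank_pos
  have heq : D * ((∑ j ∈ Z.orb i₀, logHeight (Z.rep j)) / Module.finrank ℚ K) +
      ∑ j ∈ Z.orb i₀, Real.log (‖aeval (Z.α j) P‖ / ‖Z.α j‖ ^ D) =
      (D * ∑ j ∈ Z.orb i₀, logHeight (Z.rep j) +
        Module.finrank ℚ K * ∑ j ∈ Z.orb i₀, Real.log (‖aeval (Z.α j) P‖ / ‖Z.α j‖ ^ D)) /
        Module.finrank ℚ K := by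
    field_simp
  rw [heq]
  exact div_nonneg h hn.le

end ZeroConfigK

end Roy2013

end Literature.NumberTheory.Transcendental
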